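import Summits.BirchSwinnertonDyer.BirchSwinnertonDyer.Theses.ResidualThetaTransportAtTwo
import Summits.BirchSwinnertonDyer.BirchSwinnertonDyer.Theorems.ResidualThetaTransportAtTwoResidualSignedLambdaLowerCMAtTwoStationE
import Literature.NumberTheory.EllipticCurves.Kato2004.IwasawaCohomologyCoeffNewform
import Literature.NumberTheory.EllipticCurves.NewformsCoeffFieldHolds
import Literature.NumberTheory.EllipticCurves.PadicCoeffIntegersFrobeniusData
import HarnessLib

/-!
# Station (E) `stub_kzgTrivialisation` of line `onepair` v3f (crux RSL_g `ResidualSignedLambdaLowerCMAtTwo`, stmt-BirchSwinnertonDyer-22608)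
# — the REGISTERED TEXT BY NAME: for every datum of RSL_g, every pin bundle `π` and every class `z ∈ 𝐇¹_Γ(T_ρ)`, an additive
# `ℤ₂⟦X⟧`-semilinear `e : ℤ₂⟦X⟧ⁿ ≃+ Λ_𝒪` with `e (𝒸 (s • x)) = s · e (𝒸 x)` on `Λ_𝒪·z`

Route `ResidualThetaTransportAtTwo` (RTT), crux RSL_g, line «onepair» (skeleton v3f, `Cruxes/ResidualSignedLambdaLowerCMAtTwo/Lines/onepair.lean`,
sha16 b54462f6d406cd17, LEAD rtt-p2 g20), registered KERNEL stub **`stub_kzgTrivialisation`** = station (E) of the KZ_g interior (memo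
`V3F-KZG-INTERIOR-g20.md`). Width seat `prover-bsd-wall-tp2-p2x-w2` g22 (`--supports 22608`, closes nothing by itself: the LEAD splices
`exact Theorems.OnePair.stub_kzgTrivialisation` into the line). THEOREMS ONLY (no definition, no named fact, no instance, no `sorry`). BSD is not
proved by any of this; RSL_g (22608), (R≥)ᵖ (26074) stay OPEN, KZ_g (24105) HOLD, K3 (20308) print-blocked; the PRINT stubs (`stub_kzgPrints`: Kato
Thm. 12.4 / 12.5 BY NAME, child A / child B) and station (R) are untouched.

PROOF. `intro` the S3″ prefix; `[K_g : ℚ] < ∞` (`IsNewform0.finiteDimensional_coeffField_holds`) ⟹ `[ℚ₂(S) : ℚ₂] < ∞`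
(`GreenbergSelmer.finiteDimensional_padicCoeffField`); then `OnePairPins.exists_trivialisation_span π hss ha2 hγ z` (`…StationE.lean`: PriceNode's
`exists_trivialisation` at the pins — LIN-X `cvec_map_X_smul`, LIN-𝒪 + ring hom `exists_thetaMatrixRingHom_cvec_C_smul` (Σ_bal + integral Schur),
LATTICE `exists_equivariant_addEquiv` with `n = f`). In fact `e` is `Λ_𝒪`-semilinear on ALL of `𝐇¹` (`OnePairPins.exists_trivialisation`); the
registered per-class clause follows a fortiori. Binders not used: `hcm`, `hr`, `hΔ`, `hM`, `hcmg`, `hcusp`, `hΩ`, `hcong`, `hκ`, `hcv`, the `S₀`/`Lp`/`Lm`/`d`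
clauses, `hfrob`, `ϖ`, the `Sg` clauses, `hIC` (station (E) is pure transport algebra at `v ∣ 2`).

References: [Washington1997] §7.1 Thm. 7.3, §13.2; [Kato2004Asterisque] Thm. 12.5 (1) (p. 221), §13.8 (pp. 228–229); [Kobayashi2003] Thm. 6.2 (p. 18);
[SerreInventiones1972] §1.11 Prop. 12.
-/

set_option autoImplicit false
-- the Theorems namespace of this sub repeats the summit name by design (D-0017 nested layout)
set_option linter.dupNamespace false

noncomputable section

open scoped Classical NumberField TensorProduct

namespace Summit.BirchSwinnertonDyer.BirchSwinnertonDyer.Theorems.OnePair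

open CategoryTheory Field NumberField IsDedekindDomain WeierstrassCurve
  Literature.NumberTheory.EllipticCurves Literature.NumberTheory.GaloisRepresentations
  Literature.NumberTheory.EllipticCurves.GreenbergSelmer Literature.NumberTheory.EllipticCurves.GreenbergVatsal2000
  Literature.NumberTheory.EllipticCurves.CyclotomicLayer Literature.NumberTheory.EllipticCurves.Kobayashi2003
  Literature.NumberTheory.EllipticCurves.Kato2004 Rat.HeightOneSpectrum
  Summit.BirchSwinnertonDyer.BirchSwinnertonDyer.Theorems.ThetaTransport

set_option maxHeartbeats 1600000 in
/-- **Station (E) `stub_kzgTrivialisation`** (the registered v3f text VERBATIM): for every datum of RSL_g, every one-pair pin bundle `π` and every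
class `z ∈ 𝐇¹_Γ(T_ρ)`, there is an additive `e : (Fin n → ℤ₂⟦X⟧) ≃+ Λ_𝒪`, `ℤ₂⟦X⟧`-semilinear through `padicIntToCoeffIntegers`, with
`e (π.cvec (s • x)) = s * e (π.cvec x)` for all `s ∈ Λ_𝒪` and `x ∈ Λ_𝒪·z` — `OnePairPins.exists_trivialisation_span` under the S3″ prefix.
[cite: Washington1997, §13.2, §7.1] [cite: Kato2004Asterisque, Thm. 12.5 (1) (p. 221), §13.8 (pp. 228–229)] -/
theorem stub_kzgTrivialisation :
    open Literature.NumberTheory.EllipticCurves GreenbergSelmer GreenbergVatsal2000 Kobayashi2003 ModularForms Rank1Residual Literature.NumberTheory.GaloisRepresentations Literature.NumberTheory.Automorphic IsDedekindDomain NumberField Field Rat.HeightOneSpectrum PowerSeries Summit.BirchSwinnertonDyer.BirchSwinnertonDyer.Theorems.OnePair in ∀ (W : WeierstrassCurve ℚ) [W.IsElliptic] [W.IsGloballyMinimal], ¬ W.HasCM → W.analyticRank = 0 → GoodSS W 2 → W.frobeniusTrace 2 = 0 → W.Δ < 0 → ∀ (M : ℕ) [NeZero M] (g : CuspForm (CongruenceSubgroup.Gamma0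 M) 2) (ι : coeffField g →+* PadicAlgCl 2) (Ω : ℂ), Odd M → IsNewform0 g → IsCMForm (liftToGamma1 M 2 g) → cuspCoeff g 2 = 0 → IsCohomologicalPlusPeriod g ι Ω → (∀ ℓ : ℕ, ℓ.Prime → ¬ ℓ ∣ 2 * M * W.conductorNorm ℤ → ‖embCoeff g ι ℓ - (W.frobeniusTrace ℓ : PadicAlgCl 2)‖ < 1) → ∀ (κ : ZpExtension ℚ 2) (γ : absoluteGaloisGroup ℚ), κ.IsCyclotomic → κ.IsTopGenerator γ → IsCyclotomicVariable 2 γ → ∀ (S₀ : Finset (HeightOneSpectrum (RingOfIntegers ℚ))), (∀ v ∈ S₀, ((2 : ℕ) : RingOfIntegers ℚ) ∉ v.asIdeal) → (∀ v, ¬ W.HasGoodReductionAt v → v ∈ S₀) → (∀ v, natGenerator v ∣ M → v ∈ S₀) → ∀ (Lp Lm : IwasawaAlgebraO (Set.range ι)) (d : ℕ), IsPollackPairK g ι Ω Lp Lm → (∀ k, ‖coeff k (iwasawaOToPowerSeries (Set.range ι) Lm)‖ ≤ ‖coeff d (iwasawaOToPowerSeries (Set.range ι) Lm)‖) → (∀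 k < d, ‖coeff k (iwasawaOToPowerSeries (Set.range ι) Lm)‖ < ‖coeff d (iwasawaOToPowerSeries (Set.range ι) Lm)‖) → ∀ (n : ℕ) (ρ : FramedGaloisRep ℚ (coeffO (Set.range ι)) 2) (Θ : ∀ v : HeightOneSpectrum (RingOfIntegers ℚ), ((2 : ℕ) : RingOfIntegers ℚ) ∈ v.asIdeal → (CofreeF (Set.range ι) ρ ≃+ (Fin n → ↥(W.geomPrimaryTorsion 2)))), (∀ v, ¬ natGenerator v ∣ 2 * M → ρ.IsUnramifiedAt v ∧ ∃ P : Polynomial (coeffO (Set.range ι)), P.map (padicCoeffIntegers (Set.range ι)).subtype = Polynomial.X ^ 2 - Polynomial.C (embCoeff g ι (natGenerator v)) * Polynomial.X + Polynomial.C ((natGenerator v : ℕ) : PadicAlgCl 2) ∧ ρ.HasFrobCharpolyAt v P) → ∀ (hΘ : ∀ v hv (δ : absoluteGaloisGroup (v.adicCompletion ℚ)) m i, Θ v hv (resGalOfEmb (closureEmb (K := ℚ) (v.adicCompletion ℚ)) δ • m) i = resGalOfEmb (closureEmb (K := ℚ) (v.adicCompletion ℚ)) δ • Θ v hv m i), ∀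 (ϖ : (coeffO (Set.range ι))), Irreducible ϖ → ∀ (Sg : AddSubgroup (H1Γ (Set.range ι) κ ρ)) [Module (coeffO (Set.range ι)) ↥Sg], (∀ (a : (coeffO (Set.range ι))) (s : ↥Sg), ((a • s : ↥Sg) : H1Γ (Set.range ι) κ ρ) = scalarH1 κ.kerSubgroup (CofreeF (Set.range ι) ρ) a s) → (∀ y : H1Γ (Set.range ι) κ ρ, y ∈ Sg ↔ y ∈ plusSelmerSet (Set.range ι) W κ S₀ n ρ Θ) → (∀ (τ : absoluteGaloisGroup ℚ) (y : H1Γ (Set.range ι) κ ρ), y ∈ Sg → conjH1 κ.kerSubgroup (CofreeF (Set.range ι) ρ) τ y ∈ Sg) → (plusSelmerTorsionSet (Set.range ι) W κ S₀ n ρ Θ ϖ).Finite → ∀ (I : Kato2004.IwasawaH1DataCoeff (FramedGaloisRep.toGaloisRep ρ) 2 κ γ) [Module (coeffO (Set.range ι)) I.H] [IsScalarTower (coeffO (Set.range ι)) (IwasawaAlgebraO (Set.range ι)) I.H], (∀ (a : (coeffO (Set.range ι))) (x : I.H), a • x = (PowerSeries.C a : IwasawaAlgebraO (Set.range ι)) •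 x) → ∀ (π : OnePairPins (Set.range ι) W κ γ S₀ n ρ Θ hΘ I Sg), ∀ (z : I.H), ∃ e : (Fin n → PowerSeries ℤ_[2]) ≃+ IwasawaAlgebraO (Set.range ι), (∀ (r : PowerSeries ℤ_[2]) (t : Fin n → PowerSeries ℤ_[2]), e (r • t) = PowerSeries.map (padicIntToCoeffIntegers (Set.range ι)) r * e t) ∧ ∀ (s : IwasawaAlgebraO (Set.range ι)) (x : I.H), x ∈ Submodule.span (IwasawaAlgebraO (Set.range ι)) ({z} : Set I.H) → e (π.cvec (s • x)) = s * e (π.cvec x) := by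

  intro W _ _ hcm hr hss ha2 hΔ M _ g ι Ω hM hg hcmg hcusp hΩ hcong κ γ hκ hγ hcv S₀ hS₀2 hS₀bad hS₀M Lp Lm d hPP hlam1 hlam2 n ρ Θ hfrob hΘ ϖ hϖ
    Sg _ hSg1 hSg2 hSg3 hfin I _ _ hIC π z
  haveI : FiniteDimensional ℚ (ModularForms.coeffField g) := ModularForms.IsNewform0.finiteDimensional_coeffField_holds hg
  haveI : FiniteDimensional ℚ_[2] ↥(padicCoeffField (Set.range ι)) := GreenbergSelmer.finiteDimensional_padicCoeffField ι
  exact π.exists_trivialisation_span hss ha2 hγ z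

end Summit.BirchSwinnertonDyer.BirchSwinnertonDyer.Theorems.OnePair

end
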